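import Mathlib
import Summits.Ventures.HodgeRepro.Tier4.Line2.BranchCoefficients
import Summits.Ventures.HodgeRepro.Tier4.Line2.TorsionEval

/-!
# Tier4/Line2/K1b — `exists_torsion_aeval_ne_zero_one`, the statement VERBATIM from LINE L2's skeleton
(seat t4-L2-p2, gen 0; blind re-derivation cell `pub-hodge-repro`, Tier 4, README §9–§10)

K1b of `Tier4/Line2/Skeleton.lean` (t4-plan-2, v0.8, L280–L283): a non-zero one-variable power series over the
coefficient ring `O.A` of a `BranchCoefficients` datum is non-zero at some `ζ − 1`, `ζ ∈ 𝓞_ℂ_[O.p]` a `p`-power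
root of unity.  The content is `exists_torsion_aeval_ne_zero_one_generic` (`Tier4/Line2/TorsionEval.lean`: the
landed Weierstrass finiteness of the zeros against the infinitude of the `p`-power roots of unity of `𝓞_ℂ_[p]`);
this file instantiates it at `O.algebraMap_injective`.  The statement is byte-identical to the skeleton's so that
the skeleton closes its `sorry` by this name.

Nothing here says anything about the status of the Hodge conjecture for CM abelian varieties, which is NOT
proved (HC_CM is NOT proved by anyone in this repository).
-/

set_option autoImplicit false

noncomputable section

namespace Summit.Ventures.HodgeRepro.Tier4.Line2

/-- K1b — one variable: a non-zero `G ∈ O⟦X⟧` is non-zero at some `ζ − 1`, `ζ ∈ 𝓞_{ℂ_p}` a `p`-power root of unity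
(PROVED: `exists_torsion_aeval_ne_zero_one_generic` at `O.algebraMap_injective`). -/
theorem exists_torsion_aeval_ne_zero_one (O : BranchCoefficients) (G : PowerSeries O.A) (hG : G ≠ 0) :
    ∃ ζ : 𝓞_ℂ_[O.p], (∃ n : ℕ, ζ ^ O.p ^ n = 1) ∧
      ∃ hζ : PowerSeries.HasEval (ζ - 1), PowerSeries.aeval hζ G ≠ 0 :=
  exists_torsion_aeval_ne_zero_one_generic O.algebraMap_injective G hG

end Summit.Ventures.HodgeRepro.Tier4.Line2
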